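import Mathlib
import Summits.ABC.ABC.Theses.RibetTakahashiSplit
import Summits.ABC.ABC.Theorems.RibetTakahashiSplitManyPrimeValuationProductJLPackageLemmas
import Literature.NumberTheory.Automorphic.ShimuraCurveRibetTakahashi
import Literature.NumberTheory.Automorphic.ShimuraCurveRibetTakahashiVolumeProofs
import Literature.NumberTheory.EllipticCurves.NewformPeterssonSize
import Literature.NumberTheory.EllipticCurves.ModularDegreeFormulaProofs
import Literature.NumberTheory.EllipticCurves.ModularCurveManinConstantProofs
import Literature.NumberTheory.EllipticCurves.PastenHeightBoundsIsogenyProofs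
import Literature.NumberTheory.EllipticCurves.NeronIsogenyScalingHoldsProofs
import Literature.NumberTheory.EllipticCurves.IsogenyIdProofs
import Literature.NumberTheory.Sieve.DivisorBound
import HarnessLib

/-!
# The Shimura degree lower bound FROM the paired crux, modulo cited theorems

Helper `--supports` stmt-ABC-1561 (crux
`Summit.ABC.ABC.Theses.RibetTakahashiSplit.ManyPrimeValuationProduct`, line `jl-zero-cycle-height`,
registered stub `stub_shimuraDegreeLowerBoundOfPaired`, skeleton rev c4). The line's LEVER is the
Shimura degree lower bound `log deg P ≥ log vol(X.fd) − log covol(Λ_P) − ε log N − C` for every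
Shimura-curve parametrisation datum `P` of a globally minimal elliptic `W/ℚ` semistable away from `2`
on `X₀^{D'}(M)`, `D' = ∏_{p ∈ D} p` for a covering set `D` of multiplicative primes, `N = D' M`.
This file kernel-certifies the CONVERSE direction of "lever ⟺ paired crux modulo cited theorems":
the lever FOLLOWS from the paired crux `T_D(W) = ∏_{p ∈ D} v_p(Δ_min) ≤ C_ε N^ε` (fifth hypothesis,
written out) modulo four cited inputs, in the order of the statement: the numerator half of
H. Pasten, *Shimura curves and the abc conjecture*, J. Number Theory 254 (2024) = arXiv:1705.09251,
Thm 6.1 p. 20 (`PastenShimura2024_thm_6_1`); the optimal quotient `q_{1,N} j_N`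
(`exists_optimal_modularParametrizationData`); the Goldfeld–Hoffstein–Lockhart / Murty lower bound
`(f,f) ≫_η N^{1−η}` (`murty_petersson_newform_lower_bound`); and the Mazur–Kenku radius (route item
`MazurKenkuRadius`: an isogeny of degree `≤ 163` between isogenous curves).

Proof (real bookkeeping; `η = ε/11`). For `W` globally minimal of conductor `N = D' M` (admissible,
`admissible_of_isCoveringSet`) and a datum `P` on `X`: a class-minimal datum `P₀` has
`deg P₀ ≤ deg P`; the optimal quotient gives `W₀ ∼ W` globally minimal with a classical datum `D₀`
of degree `δ₁`; Thm 6.1 (numerator): `δ₁ b = a · deg P₀ · T_D`, `a ≤ 163^{#D}`, `b ≥ 1`; Zagier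
(PROVED, `zagier_degree_formula_holds`): `4π² c² (f,f) = δ₁ covol(Λ_{D₀})` with `c ∈ ℤ ∖ {0}`
(`maninConstant_ne_zero_holds`), so `δ₁ covol(Λ_{D₀}) ≥ 4π² (f,f)`; GHL: `(f,f) ≥ c₀ N^{1−η}`; the
radius with Faltings' integral Néron scaling (PROVED, `integral_neronScaling_of_isGloballyMinimal_holds`,
`covolume_le_degree_mul_covolume_of_integral_neronScaling'`): `covol(Λ_{D₀}) ≤ 163 covol(Λ_P)`;
the paired crux: `T_D ≤ C₂ N^η`; `a ≤ 163^{#D} ≤ (2^{#D})^8 ≤ d(D')^8 ≤ C_η^8 N^{8η}`; and Shimizu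
(PROVED, `ShimuraCurveData.volume_fd_eq_holds`): `vol(X.fd) = (π/3) φ(D') ψ(M) ≤ (π/3) D' d(M) M
≤ (π/3) C_η N^{1+η}` (`ψ(M) ≤ d(M) M`, `gamma0Index_le_card_divisors_mul`). Collecting logarithms:
`log deg P ≥ log vol − log covol(Λ_P) − 11 η log N − C`.
-/

-- `Summit.ABC.ABC` is the mandated summit-side namespace (CONVENTIONS §2); the duplicate is deliberate.
set_option linter.dupNamespace false

noncomputable section

open MeasureTheory
open scoped MatrixGroups

namespace Summit.ABC.ABC.Theorems.ManyPrimeValuationProduct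

open Literature.NumberTheory.Automorphic
open Literature.NumberTheory.EllipticCurves.ModularForms
open CongruenceSubgroup
open Summit.ABC.ABC.Theorems.ManyPrimeValuationProduct.JLPackage

/-- `ψ(M) = ∏_{p^e ∥ M} p^{e−1}(p+1) ≤ d(M) · M`: termwise `p^{e−1}(p+1) ≤ 2 p^e ≤ (e+1) p^e`, with
`d(M) = ∏ (e+1)` (`Nat.card_divisors`) and `M = ∏ p^e`. `[folklore]` -/
theorem gamma0Index_le_card_divisors_mul (M : ℕ) (hM : M ≠ 0) :
    gamma0Index M ≤ M.divisors.card * M := by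
  have h1 : gamma0Index M ≤ M.factorization.prod (fun p e => (e + 1) * p ^ e) := by
    unfold gamma0Index Finsupp.prod
    refine Finset.prod_le_prod' fun p hp => ?_
    have hp' : p ∈ M.primeFactors := hp
    have hp2 : 2 ≤ p := (Nat.prime_of_mem_primeFactors hp').two_le
    have he : 1 ≤ M.factorization p := Nat.pos_of_ne_zero (Finsupp.mem_support_iff.mp hp)
    calc p ^ (M.factorization p - 1) * (p + 1)
        ≤ p ^ (M.factorization p - 1) * (2 * p) := Nat.mul_le_mul_left _ (by omega)
      _ = 2 * p ^ M.factorization p := by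
          rw [mul_left_comm, ← pow_succ, Nat.sub_add_cancel he]
      _ ≤ (M.factorization p + 1) * p ^ M.factorization p := Nat.mul_le_mul_right _ (by omega)
  have h2 : M.factorization.prod (fun p e => (e + 1) * p ^ e) = M.divisors.card * M := by
    rw [Finsupp.prod_mul, Nat.prod_factorization_pow_eq_self hM, Nat.card_divisors hM]
    rfl
  exact h1.trans h2.le

/-- **The Shimura degree lower bound from the paired crux** (registered stub
`stub_shimuraDegreeLowerBoundOfPaired` of line `jl-zero-cycle-height`, rev c4): modulo Pasten's
Thm 6.1 (numerator), the optimal quotient, the GHL lower bound `(f,f) ≫ N^{1−η}` and the Mazur–Kenku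
radius, the paired crux `T_D ≤ C_ε N^ε` implies
`log vol(X.fd) − log covol(Λ_P) − (ε log N + C) ≤ log deg P` for every datum `P` of a globally
minimal `W` semistable away from `2` on the Shimura curve of a covering set (module docstring for
the chain; Pasten arXiv:1705.09251 §16 run backwards). `[folklore]` -/
theorem stub_shimuraDegreeLowerBoundOfPaired :
    Literature.NumberTheory.Automorphic.PastenShimura2024_thm_6_1 →
    Literature.NumberTheory.Automorphic.exists_optimal_modularParametrizationData →
    Literature.NumberTheory.EllipticCurves.ModularForms.murty_petersson_newform_lower_bound →
    Summit.ABC.ABC.Theses.RibetTakahashiSplit.MazurKenkuRadius →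
    (∀ ε : ℝ, 0 < ε → ∃ C : ℝ, ∀ (W : WeierstrassCurve ℚ) [W.IsElliptic],
      (∀ p : ℕ, p.Prime → p ≠ 2 → ¬ p ^ 2 ∣ W.conductorNorm ℤ) →
      ∀ D : Finset ℕ,
        (D ⊆ (W.conductorNorm ℤ).primeFactors.filter (fun p => ¬ p ^ 2 ∣ W.conductorNorm ℤ) ∧
          Even D.card ∧ 2 ≤ D.card ∧
          2 ≤ ((W.conductorNorm ℤ).primeFactors.filter (fun p => ¬ p ^ 2 ∣ W.conductorNorm ℤ) \
            D).card) →
        ((∏ p ∈ D, (W.minimalDiscriminantNorm ℤ).factorization p : ℕ) : ℝ) ≤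
          C * (W.conductorNorm ℤ : ℝ) ^ ε) →
    ∀ ε : ℝ, 0 < ε → ∃ C : ℝ, ∀ (W : WeierstrassCurve ℚ) [W.IsElliptic] [W.IsGloballyMinimal],
      (∀ p : ℕ, p.Prime → p ≠ 2 → ¬ p ^ 2 ∣ W.conductorNorm ℤ) →
      ∀ D : Finset ℕ,
        (D ⊆ (W.conductorNorm ℤ).primeFactors.filter (fun p => ¬ p ^ 2 ∣ W.conductorNorm ℤ) ∧
          Even D.card ∧ 2 ≤ D.card ∧
          2 ≤ ((W.conductorNorm ℤ).primeFactors.filter (fun p => ¬ p ^ 2 ∣ W.conductorNorm ℤ) \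
            D).card) →
      ∀ M : ℕ, (∏ p ∈ D, p) * M = W.conductorNorm ℤ →
      ∀ (X : Literature.NumberTheory.Automorphic.ShimuraCurveData (∏ p ∈ D, p) M)
        (P : Literature.NumberTheory.Automorphic.ShimuraParametrizationData X W),
        Real.log (MeasureTheory.volume X.fd).toReal - Real.log (ZLattice.covolume P.L.lattice) -
          (ε * Real.log (W.conductorNorm ℤ) + C) ≤ Real.log (P.deg : ℝ) := by
  intro h61n hopt hGHL hR hP ε hε
  -- constants, chosen before the curve
  set η : ℝ := ε / 11 with hηdef
  have hη : 0 < η := by positivity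
  obtain ⟨Cη, hCη1, hCη⟩ := Literature.NumberTheory.Sieve.exists_card_divisors_le_mul_rpow' hη
  obtain ⟨c₀, hc₀, hG⟩ := hGHL η hη
  obtain ⟨C₂, hC₂⟩ := hP η hη
  set C₂' : ℝ := max C₂ 1 with hC₂'def
  have hCη0 : 0 < Cη := by linarith
  have hC₂'1 : 1 ≤ C₂' := le_max_right _ _
  have hC₂'0 : 0 < C₂' := by linarith
  set C : ℝ := Real.log (Real.pi / 3) + 9 * Real.log Cη - Real.log (4 * Real.pi ^ 2) -
    Real.log c₀ + Real.log 163 + Real.log C₂' with hCdef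
  refine ⟨C, fun W _ _ hss D hD M hDM X P => ?_⟩
  -- the conductor, the covering set, the admissible factorisation `N = D' M`
  set N := W.conductorNorm ℤ with hNdef
  have hNpos : 0 < N := W.conductorNorm_pos_holds
  haveI : NeZero N := ⟨hNpos.ne'⟩
  have hprime : ∀ p ∈ D, p.Prime := fun p hp => prime_of_mem hD.1 hp
  obtain ⟨hadm₀, -⟩ := admissible_of_isCoveringSet hD.1 hD.2.1
  have hD'pos : 0 < ∏ p ∈ D, p := hadm₀.pos_left
  have hMeq : N / (∏ p ∈ D, p) = M := by
    rw [← hDM]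
    exact Nat.mul_div_cancel_left M hD'pos
  have hadm : IsAdmissibleFactorization N (∏ p ∈ D, p) M := by
    rw [← hMeq]
    exact hadm₀
  have hMpos : 0 < M := hadm.pos_right
  have hωD : (∏ p ∈ D, p).primeFactors = D := primeFactors_prod_primes hprime
  -- (1) a class-minimal datum, (2) the optimal quotient, (3) Thm 6.1 (numerator), (6) the radius
  obtain ⟨W₀', hW₀', P₀, hP₀⟩ := exists_class_minimal P
  obtain ⟨W₀, hW₀e, hW₀m, D₀, hnew, hiso, hD₀min⟩ := hopt N W hNdef.symm
  obtain ⟨a, b, ha, hb, ha163, -, hEq⟩ := h61n hadm X W hNdef.symm W₀ D₀ hnew hD₀min W₀' P₀ hP₀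
  rw [hωD] at ha163 hEq
  obtain ⟨φ, hφ⟩ := hR W W₀ hiso
  have hd₀d : P₀.deg ≤ P.deg := by
    have hP₀' := hP₀
    obtain ⟨-, hmin⟩ := hP₀'
    exact hmin W P (WeierstrassCurve.IsIsogenous.refl_holds W)
  -- names for the real quantities
  set Tn : ℕ := ∏ p ∈ D, (W.minimalDiscriminantNorm ℤ).factorization p with hTdef
  set V : ℝ := ZLattice.covolume P.L.lattice with hVdef
  set V₀ : ℝ := ZLattice.covolume D₀.L.lattice with hV₀def
  set ff : ℝ := (peterssonProduct (Gamma0 N) 2 D₀.f D₀.f).re with hffdef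
  set vol : ℝ := (volume X.fd).toReal with hvoldef
  -- positivity
  have hN1 : (1 : ℝ) ≤ N := by exact_mod_cast hNpos
  have hNr : (0 : ℝ) < N := by positivity
  have hd₀pos : (0 : ℝ) < P₀.deg := by exact_mod_cast P₀.deg_pos
  have hδ₁pos : (0 : ℝ) < D₀.deg := by exact_mod_cast D₀.deg_pos
  have hapos : (0 : ℝ) < a := by exact_mod_cast ha
  have hbpos : (0 : ℝ) < b := by exact_mod_cast hb
  have hb1 : (1 : ℝ) ≤ b := by exact_mod_cast hb
  have hV : 0 < V := ZLattice.covolume_pos _ _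
  have hV₀ : 0 < V₀ := ZLattice.covolume_pos _ _
  -- (4) Zagier and the non-zero integral Manin constant
  have hz := D₀.zagier_degree_formula_holds
  have hff0 : 0 < ff := hz.peterssonProduct_re_pos
  have hzr : 4 * Real.pi ^ 2 * (D₀.c : ℝ) ^ 2 * ff = D₀.deg * V₀ := by
    have := congrArg Complex.re hz
    rwa [Complex.re_ofReal_mul, Complex.ofReal_re] at this
  have hc1 : (1 : ℝ) ≤ (D₀.c : ℝ) ^ 2 := by
    have h0 : D₀.c ≠ 0 := D₀.maninConstant_ne_zero_holds
    have habs : (1 : ℝ) ≤ |(D₀.c : ℝ)| := by exact_mod_cast Int.one_le_abs h0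
    rw [← sq_abs]
    exact one_le_pow₀ habs
  -- (3) the identity of Thm 6.1 in `ℝ`, and `T_D > 0`
  have hEq' : (D₀.deg : ℝ) * b = a * P₀.deg * Tn := by
    have : ((D₀.modularDegree * b : ℕ) : ℝ) = ((a * P₀.deg * Tn : ℕ) : ℝ) := by
      exact_mod_cast hEq
    push_cast at this
    exact this
  have hTpos : (0 : ℝ) < Tn := by
    have h : (0 : ℝ) < a * P₀.deg * Tn := by rw [← hEq']; positivity
    rcases (Nat.cast_nonneg (α := ℝ) Tn).lt_or_eq with h0 | h0
    · exact h0
    · rw [← h0, mul_zero] at h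
      exact absurd h (lt_irrefl _)
  -- (5) GHL, (6) the covolume comparison along the radius, (7) the paired crux
  have hGN : c₀ * (N : ℝ) ^ (1 - η) ≤ ff := hG N W D₀.f hnew
  have hVV : V₀ ≤ φ.degree * V :=
    covolume_le_degree_mul_covolume_of_integral_neronScaling'
      Literature.NumberTheory.EllipticCurves.integral_neronScaling_of_isGloballyMinimal_holds W W₀
      P.isNeronLattice D₀.isNeronLattice φ
  have hφdeg : (φ.degree : ℝ) ≤ 163 := by exact_mod_cast hφ
  have hT : (Tn : ℝ) ≤ C₂ * (N : ℝ) ^ η := hC₂ W hss D hD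
  -- (8) the divisor bound `2^{#D} ≤ d(D') ≤ C_η N^η`
  have hdiv : (2 : ℝ) ^ D.card ≤ Cη * (N : ℝ) ^ η := by
    have h1 : ((2 ^ D.card : ℕ) : ℝ) ≤ ((∏ p ∈ D, p).divisors.card : ℝ) := by
      exact_mod_cast two_pow_card_le_card_divisors hprime
    have h2 := hCη (∏ p ∈ D, p)
    have h3 : ((∏ p ∈ D, p : ℕ) : ℝ) ^ η ≤ (N : ℝ) ^ η := by
      apply Real.rpow_le_rpow (by positivity) _ hη.le
      exact_mod_cast Nat.le_of_dvd hNpos (hDM ▸ dvd_mul_right (∏ p ∈ D, p) M)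
    push_cast at h1
    calc (2 : ℝ) ^ D.card ≤ (∏ p ∈ D, p).divisors.card := h1
      _ ≤ Cη * ((∏ p ∈ D, p : ℕ) : ℝ) ^ η := h2
      _ ≤ Cη * (N : ℝ) ^ η := mul_le_mul_of_nonneg_left h3 hCη0.le
  -- (9) the volume `vol(X.fd) = (π/3) φ(D') ψ(M) ≤ (π/3) C_η N^{1+η}`
  have hv := Literature.NumberTheory.Automorphic.ShimuraCurveData.volume_fd_eq_holds X hMpos
  have hvoleq : vol = Real.pi / 3 * ((Nat.totient (∏ p ∈ D, p) * gamma0Index M : ℕ) : ℝ) := by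
    rw [hvoldef, hv, ENNReal.toReal_ofReal (by positivity)]
  have hvol0 : 0 < vol := by
    rw [hvoleq]
    have : 0 < Nat.totient (∏ p ∈ D, p) * gamma0Index M :=
      Nat.mul_pos (Nat.totient_pos.mpr hD'pos)
        (hMpos.trans_le (JLPackage.le_gamma0Index M hMpos.ne'))
    positivity
  have hvolle : vol ≤ Real.pi / 3 * Cη * ((N : ℝ) * (N : ℝ) ^ η) := by
    have h1 : ((Nat.totient (∏ p ∈ D, p) * gamma0Index M : ℕ) : ℝ) ≤
        ((∏ p ∈ D, p : ℕ) : ℝ) * ((M.divisors.card : ℝ) * M) := by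
      have := Nat.mul_le_mul (Nat.totient_le (∏ p ∈ D, p))
        (gamma0Index_le_card_divisors_mul M hMpos.ne')
      exact_mod_cast this
    have h2 : (M.divisors.card : ℝ) ≤ Cη * (M : ℝ) ^ η := hCη M
    have h3 : (M : ℝ) ^ η ≤ (N : ℝ) ^ η :=
      Real.rpow_le_rpow (by positivity)
        (by exact_mod_cast Nat.le_of_dvd hNpos (hDM ▸ dvd_mul_left M (∏ p ∈ D, p))) hη.le
    have h4 : ((∏ p ∈ D, p : ℕ) : ℝ) * M = N := by exact_mod_cast hDM
    rw [hvoleq]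
    calc Real.pi / 3 * ((Nat.totient (∏ p ∈ D, p) * gamma0Index M : ℕ) : ℝ)
        ≤ Real.pi / 3 * (((∏ p ∈ D, p : ℕ) : ℝ) * ((M.divisors.card : ℝ) * M)) :=
          mul_le_mul_of_nonneg_left h1 (by positivity)
      _ = Real.pi / 3 * (M.divisors.card : ℝ) * (((∏ p ∈ D, p : ℕ) : ℝ) * M) := by ring
      _ = Real.pi / 3 * (M.divisors.card : ℝ) * N := by rw [h4]
      _ ≤ Real.pi / 3 * (Cη * (M : ℝ) ^ η) * N :=
          mul_le_mul_of_nonneg_right (mul_le_mul_of_nonneg_left h2 (by positivity)) hNr.le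
      _ ≤ Real.pi / 3 * (Cη * (N : ℝ) ^ η) * N :=
          mul_le_mul_of_nonneg_right
            (mul_le_mul_of_nonneg_left (mul_le_mul_of_nonneg_left h3 hCη0.le) (by positivity))
            hNr.le
      _ = Real.pi / 3 * Cη * (N * (N : ℝ) ^ η) := by ring
  -- (10) the logarithmic chain
  have l1 : Real.log (P₀.deg : ℝ) ≤ Real.log (P.deg : ℝ) :=
    Real.log_le_log hd₀pos (by exact_mod_cast hd₀d)
  have l2 : Real.log (D₀.deg : ℝ) ≤
      Real.log (a : ℝ) + Real.log (P₀.deg : ℝ) + Real.log (Tn : ℝ) := by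
    have h : (D₀.deg : ℝ) ≤ a * P₀.deg * Tn := by
      rw [← hEq']
      exact le_mul_of_one_le_right hδ₁pos.le hb1
    have := Real.log_le_log hδ₁pos h
    rwa [Real.log_mul (by positivity) hTpos.ne', Real.log_mul hapos.ne' hd₀pos.ne'] at this
  have l3 : Real.log (4 * Real.pi ^ 2) + Real.log ff ≤ Real.log (D₀.deg : ℝ) + Real.log V₀ := by
    have h : 4 * Real.pi ^ 2 * ff ≤ (D₀.deg : ℝ) * V₀ := by
      rw [← hzr]
      have h0 : 0 ≤ 4 * Real.pi ^ 2 * ff := by positivity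
      calc 4 * Real.pi ^ 2 * ff = 4 * Real.pi ^ 2 * ff * 1 := (mul_one _).symm
        _ ≤ 4 * Real.pi ^ 2 * ff * (D₀.c : ℝ) ^ 2 := mul_le_mul_of_nonneg_left hc1 h0
        _ = 4 * Real.pi ^ 2 * (D₀.c : ℝ) ^ 2 * ff := by ring
    have := Real.log_le_log (by positivity) h
    rwa [Real.log_mul (by positivity) hff0.ne', Real.log_mul hδ₁pos.ne' hV₀.ne'] at this
  have l4 : Real.log c₀ + (1 - η) * Real.log N ≤ Real.log ff := by
    have := Real.log_le_log (by positivity) hGN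
    rwa [Real.log_mul hc₀.ne' (by positivity), Real.log_rpow hNr] at this
  have l5 : Real.log V₀ ≤ Real.log 163 + Real.log V := by
    have h : V₀ ≤ 163 * V := hVV.trans (mul_le_mul_of_nonneg_right hφdeg hV.le)
    have := Real.log_le_log hV₀ h
    rwa [Real.log_mul (by norm_num) hV.ne'] at this
  have l6 : Real.log (Tn : ℝ) ≤ Real.log C₂' + η * Real.log N := by
    have h : (Tn : ℝ) ≤ C₂' * (N : ℝ) ^ η :=
      hT.trans (mul_le_mul_of_nonneg_right (le_max_left _ _) (by positivity))
    have := Real.log_le_log hTpos h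
    rwa [Real.log_mul hC₂'0.ne' (by positivity), Real.log_rpow hNr] at this
  have l7 : Real.log (a : ℝ) ≤ 8 * (Real.log Cη + η * Real.log N) := by
    have h1 : Real.log (a : ℝ) ≤ D.card * Real.log 163 := by
      have h : (a : ℝ) ≤ 163 ^ D.card := by exact_mod_cast ha163
      have := Real.log_le_log hapos h
      rwa [Real.log_pow] at this
    have h2 : Real.log 163 ≤ 8 * Real.log 2 := by
      have h := Real.log_le_log (by norm_num : (0 : ℝ) < 163) (by norm_num : (163 : ℝ) ≤ 2 ^ 8)
      rw [Real.log_pow] at h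
      exact_mod_cast h
    have h3 : (D.card : ℝ) * Real.log 2 ≤ Real.log Cη + η * Real.log N := by
      have := Real.log_le_log (by positivity) hdiv
      rwa [Real.log_pow, Real.log_mul hCη0.ne' (by positivity), Real.log_rpow hNr] at this
    calc Real.log (a : ℝ) ≤ D.card * Real.log 163 := h1
      _ ≤ D.card * (8 * Real.log 2) := mul_le_mul_of_nonneg_left h2 (Nat.cast_nonneg _)
      _ = 8 * (D.card * Real.log 2) := by ring
      _ ≤ 8 * (Real.log Cη + η * Real.log N) := by linarith
  have l8 : Real.log vol ≤ Real.log (Real.pi / 3) + Real.log Cη + (1 + η) * Real.log N := by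
    have := Real.log_le_log hvol0 hvolle
    rw [Real.log_mul (by positivity) (by positivity), Real.log_mul (by positivity) hCη0.ne',
      Real.log_mul hNr.ne' (by positivity), Real.log_rpow hNr] at this
    linarith
  have hεη : ε * Real.log N = 11 * (η * Real.log N) := by
    rw [hηdef]
    ring
  linarith [l1, l2, l3, l4, l5, l6, l7, l8, hεη, hCdef]

end Summit.ABC.ABC.Theorems.ManyPrimeValuationProduct

end
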